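import Mathlib

/-!
# Pointwise corank from separators: `|φ(SL₂ k)|·|Z|` independent real frame functions vanishing
# on the garbage set
# (crux `LevelGradedCohnUmans.GradedDesignFamily`, stmt-MatrixMultiplication-7610; negative side,
# line `quadratic-extension-level-one-cell`, stub `gl2Flat_corank_of_separators`)

Setting: an injective hom `φ : SL₂(k) →* GL₂(K)`, finite sets `Y, Z ⊆ GL₂(K)` with `Y` nonempty,
and the level-one separation clause of the line's design stub S3: for every target `z₀ ∈ Z` a
table `cf : K² → K² → ℂ` with `Σ_u cf u ((φ a · y · y'⁻¹ · z) u) = [a = 1 ∧ y = y' ∧ z = z₀]` on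
`SL₂(k) × Y × Y × Z`.  Let `Γ ⊆ GL₂(K)` consist of "garbage words" `φ a · y · y'⁻¹ · z` with
`y, y' ∈ Y`, `z ∈ Z`, `y ≠ y'`.

* `gl2Flat_corank_of_separators` — there is a real subspace `W` of functions `GL₂(K) → ℝ`,
  contained in the real span of the indicator functions `g ↦ [g u = w]` (`u, w ∈ K²`), all of
  whose members vanish on `Γ`, with `|φ(SL₂ k)| · |Z| ≤ dim_ℝ W`.

This is ingredient (iv) of the flat-size lemma of the line's negative programme: under S3's clause
the garbage set `φ(SL₂ k) · (Y Y⁻¹ ∖ 1) · Z` has corank at least `|φ(SL₂ k)| · |Z|` in the real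
level-one test space.

PROOF.  `W` is the real span of the functions `e_(a₀, z₀) : g ↦ Re Σ_u cf_{z₀} u ((φ a₀ · g) u)`
for `a₀ ∈ SL₂(k)`, `z₀ ∈ Z`.
(A) Since `(φ a₀ · g) u = (φ a₀) (g u)`, for each `g` and `u` exactly one `w` (namely `w = g u`)
contributes, so `e_(a₀, z₀) = Σ_{u, w} Re (cf_{z₀} u ((φ a₀) w)) · [· u = w]` is a real combination
of indicators.
(B) At a garbage word, `φ a₀ · (φ a · y · y'⁻¹ · z) = φ (a₀ a) · y · y'⁻¹ · z` with `y ≠ y'`, so the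
separation clause gives `e_(a₀, z₀) = Re 0 = 0` there.
(C) Fix `y₁ ∈ Y`.  Then `e_(a₀, z₀) (φ b · z₁) = [a₀ b = 1 ∧ z₁ = z₀]` (the clause at
`(a₀ b, y₁, y₁, z₁)`), so evaluating a vanishing real combination `Σ_i l_i e_i = 0` at the point
`φ a₁⁻¹ · z₁` isolates the coefficient `l_(a₁, z₁)`: the `e_i` are linearly independent, hence
`dim W = |SL₂(k)| · |Z| = |φ(SL₂ k)| · |Z|` (`finrank_span_eq_card`, injectivity of `φ`).

Sorry-free; axioms `propext`, `Classical.choice`, `Quot.sound`.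
-/

set_option linter.dupNamespace false

open scoped BigOperators

namespace Summit.MatrixMultiplication.MatrixMultiplication.Theorems.GradedDesignFamily.Negative

/-- **Pointwise corank from separators.**  Let `φ : SL₂(k) →* GL₂(K)` be injective, `Y, Z ⊆ GL₂(K)`
finite with `Y` nonempty, and suppose the level-one separation clause: for every `z₀ ∈ Z` a table
`cf : K² → K² → ℂ` with `Σ_u cf u ((φ a · y · y'⁻¹ · z) u) = [a = 1 ∧ y = y' ∧ z = z₀]` for all
`a ∈ SL₂(k)`, `y, y' ∈ Y`, `z ∈ Z`.  If every element of `Γ` is a garbage word `φ a · y · y'⁻¹ · z`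
with `y ≠ y'`, then there is a real subspace `W` of functions `GL₂(K) → ℝ`, inside the real span of
the indicators `g ↦ [g u = w]`, all of whose members vanish on `Γ`, with
`|φ(SL₂ k)| · |Z| ≤ dim_ℝ W`: the real span of `g ↦ Re Σ_u cf_{z₀} u ((φ a₀ · g) u)`,
`(a₀, z₀) ∈ SL₂(k) × Z`, which are linearly independent by evaluation at the points `φ a₁⁻¹ · z₁`. -/
theorem gl2Flat_corank_of_separators : ∀ {k K : Type} [Field k] [Fintype k] [DecidableEq k]
    [Field K] [Fintype K] [DecidableEq K]
    (φ : Matrix.SpecialLinearGroup (Fin 2) k →* Matrix.GeneralLinearGroup (Fin 2) K),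
    Function.Injective φ → ∀ (Y Z : Finset (Matrix.GeneralLinearGroup (Fin 2) K)), Y.Nonempty →
    (∀ z₀ ∈ Z, ∃ cf : (Fin 2 → K) → (Fin 2 → K) → ℂ,
      ∀ a : Matrix.SpecialLinearGroup (Fin 2) k, ∀ y ∈ Y, ∀ y' ∈ Y, ∀ z ∈ Z,
        (∑ u : Fin 2 → K, cf u (((φ a * y * y'⁻¹ * z : Matrix.GeneralLinearGroup (Fin 2) K) :
            Matrix (Fin 2) (Fin 2) K).mulVec u)) = if a = 1 ∧ y = y' ∧ z = z₀ then 1 else 0) →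
    ∀ Γ : Finset (Matrix.GeneralLinearGroup (Fin 2) K),
    (∀ x ∈ Γ, ∃ a : Matrix.SpecialLinearGroup (Fin 2) k, ∃ y ∈ Y, ∃ y' ∈ Y, ∃ z ∈ Z,
        y ≠ y' ∧ x = φ a * y * y'⁻¹ * z) →
    ∃ W : Submodule ℝ (Matrix.GeneralLinearGroup (Fin 2) K → ℝ),
      W ≤ Submodule.span ℝ (Set.range fun p : (Fin 2 → K) × (Fin 2 → K) =>
        fun g : Matrix.GeneralLinearGroup (Fin 2) K =>
          if (g : Matrix (Fin 2) (Fin 2) K).mulVec p.1 = p.2 then (1 : ℝ) else 0) ∧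
      (∀ f ∈ W, ∀ x ∈ Γ, f x = 0) ∧
      (Finset.univ.image φ).card * Z.card ≤ Module.finrank ℝ W := by
  intro k K _ _ _ _ _ _ φ hφ Y Z hY hsep Γ hΓ
  choose cf hcf using hsep
  obtain ⟨y₁, hy₁⟩ := hY
  -- the real frame functions `e (a₀, z₀) : g ↦ Re Σ_u cf_{z₀} u ((φ a₀ · g) u)`
  obtain ⟨e, he⟩ : ∃ e : Matrix.SpecialLinearGroup (Fin 2) k × {z // z ∈ Z} →
      Matrix.GeneralLinearGroup (Fin 2) K → ℝ,
      ∀ (a₀ : Matrix.SpecialLinearGroup (Fin 2) k) (z₀ : Matrix.GeneralLinearGroup (Fin 2) K)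
        (hz₀ : z₀ ∈ Z) (g : Matrix.GeneralLinearGroup (Fin 2) K), e (a₀, ⟨z₀, hz₀⟩) g =
        (∑ u : Fin 2 → K, cf z₀ hz₀ u
          (((φ a₀ * g : Matrix.GeneralLinearGroup (Fin 2) K) : Matrix (Fin 2) (Fin 2) K).mulVec
            u)).re :=
    ⟨fun i g => (∑ u : Fin 2 → K, cf i.2.1 i.2.2 u
      (((φ i.1 * g : Matrix.GeneralLinearGroup (Fin 2) K) : Matrix (Fin 2) (Fin 2) K).mulVec
        u)).re, fun _ _ _ _ => rfl⟩
  -- (C, pointwise) the value of `e (a₀, z₀)` at a clean word `φ b · z₁`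
  have hE : ∀ (a₀ b : Matrix.SpecialLinearGroup (Fin 2) k) (z₀ : Matrix.GeneralLinearGroup (Fin 2) K)
      (hz₀ : z₀ ∈ Z) (z₁ : Matrix.GeneralLinearGroup (Fin 2) K) (hz₁ : z₁ ∈ Z),
      e (a₀, ⟨z₀, hz₀⟩) (φ b * z₁) = if a₀ * b = 1 ∧ z₁ = z₀ then (1 : ℝ) else 0 := by
    intro a₀ b z₀ hz₀ z₁ hz₁
    have h1 : φ a₀ * (φ b * z₁) = φ (a₀ * b) * y₁ * y₁⁻¹ * z₁ := by
      rw [mul_inv_cancel_right, map_mul, mul_assoc]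
    rw [he, h1, hcf z₀ hz₀ (a₀ * b) y₁ hy₁ y₁ hy₁ z₁ hz₁]
    by_cases h : a₀ * b = 1 ∧ z₁ = z₀
    · rw [if_pos h, if_pos (show a₀ * b = 1 ∧ y₁ = y₁ ∧ z₁ = z₀ from ⟨h.1, rfl, h.2⟩),
        Complex.one_re]
    · rw [if_neg h, if_neg (show ¬(a₀ * b = 1 ∧ y₁ = y₁ ∧ z₁ = z₀) from
        fun h' => h ⟨h'.1, h'.2.2⟩), Complex.zero_re]
  -- (B, pointwise) each `e i` vanishes on the garbage set
  have hB : ∀ i : Matrix.SpecialLinearGroup (Fin 2) k × {z // z ∈ Z}, ∀ x ∈ Γ, e i x = 0 := by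
    rintro ⟨a₀, z₀, hz₀⟩ x hx
    obtain ⟨a, y, hy, y', hy', z, hz, hne, rfl⟩ := hΓ x hx
    have h1 : φ a₀ * (φ a * y * y'⁻¹ * z) = φ (a₀ * a) * y * y'⁻¹ * z := by
      simp only [map_mul, mul_assoc]
    have hc : ¬(a₀ * a = 1 ∧ y = y' ∧ z = z₀) := fun h => hne h.2.1
    rw [he, h1, hcf z₀ hz₀ (a₀ * a) y hy y' hy' z hz, if_neg hc, Complex.zero_re]
  refine ⟨Submodule.span ℝ (Set.range e), ?_, ?_, ?_⟩
  · -- (A) each `e i` is a real combination of indicator functions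
    refine Submodule.span_le.2 ?_
    rintro _ ⟨⟨a₀, z₀, hz₀⟩, rfl⟩
    have hfun : e (a₀, ⟨z₀, hz₀⟩) = ∑ u : Fin 2 → K, ∑ w : Fin 2 → K,
        (cf z₀ hz₀ u ((φ a₀ : Matrix (Fin 2) (Fin 2) K).mulVec w)).re •
          (fun g : Matrix.GeneralLinearGroup (Fin 2) K =>
            if (g : Matrix (Fin 2) (Fin 2) K).mulVec u = w then (1 : ℝ) else 0) := by
      funext g
      rw [he]
      simp only [Finset.sum_apply, Pi.smul_apply, smul_eq_mul, mul_ite, mul_one, mul_zero]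
      rw [Complex.re_sum]
      refine Finset.sum_congr rfl fun u _ => ?_
      rw [Finset.sum_ite_eq, if_pos (Finset.mem_univ _), Units.val_mul, Matrix.mulVec_mulVec]
    rw [SetLike.mem_coe, hfun]
    exact sum_mem fun u _ => sum_mem fun w _ =>
      Submodule.smul_mem _ _ (Submodule.subset_span ⟨(u, w), rfl⟩)
  · -- (B) every member of the span vanishes on `Γ`
    intro f hf x hx
    induction hf using Submodule.span_induction with
    | mem f h =>
      obtain ⟨i, rfl⟩ := h
      exact hB i x hx
    | zero => rfl
    | add f f' _ _ hf hf' => rw [Pi.add_apply, hf, hf', add_zero]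
    | smul r f _ hf => rw [Pi.smul_apply, hf, smul_zero]
  · -- (C) linear independence by evaluation, hence the dimension count
    have hli : LinearIndependent ℝ e := by
      rw [Fintype.linearIndependent_iff]
      rintro l hl ⟨a₁, z₁, hz₁⟩
      have key := congr_fun hl (φ a₁⁻¹ * z₁)
      simp only [Finset.sum_apply, Pi.smul_apply, smul_eq_mul, Pi.zero_apply] at key
      have hval : ∀ i : Matrix.SpecialLinearGroup (Fin 2) k × {z // z ∈ Z},
          i ≠ (a₁, ⟨z₁, hz₁⟩) → l i * e i (φ a₁⁻¹ * z₁) = 0 := by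
        rintro ⟨b, z₂, hz₂⟩ hne
        have hc : ¬(b * a₁⁻¹ = 1 ∧ z₁ = z₂) := by
          rintro ⟨h1, h2⟩
          obtain rfl := mul_inv_eq_one.1 h1
          obtain rfl := h2
          exact hne rfl
        rw [hE b a₁⁻¹ z₂ hz₂ z₁ hz₁, if_neg hc, mul_zero]
      rw [Fintype.sum_eq_single _ hval, hE a₁ a₁⁻¹ z₁ hz₁ z₁ hz₁,
        if_pos (show a₁ * a₁⁻¹ = 1 ∧ z₁ = z₁ from ⟨mul_inv_cancel a₁, rfl⟩), mul_one] at key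
      exact key
    refine le_of_eq ?_
    rw [finrank_span_eq_card hli, Fintype.card_prod, Fintype.card_coe,
      Finset.card_image_of_injective _ hφ, Finset.card_univ]

end Summit.MatrixMultiplication.MatrixMultiplication.Theorems.GradedDesignFamily.Negative
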